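import Summits.NavierStokesRegularity.NavierStokesRegularity.Theorems.SoloSalvageJormakka2010
import HarnessLib

/-!
# D-0090 NS-CLAIMS, C02 `Jormakka2010` — SALVAGE part 3: Theorem 2.2 (non-uniqueness, C1/C2) holds

Cell ns-claims, salvage seat `ns-claims-salvage-p2`, solo lane; companion of
`SoloSalvageJormakka2010.lean`. The skeleton's `Literature.Claims.NS.Jormakka2010.Theorem22 ν`
types Theorem 2.2 (EJDE 2010/93, p. 3) as printed: a periodic smooth divergence-free datum `u⁰`
with (C1) infinitely many pairs `(u, p) ∈ C^∞(ℝ³ × [0,∞))` solving (1.1)–(1.3) with `f ≡ 0`,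
(C2) an unbounded such pair, and a bounded one with `u` and `p` periodic. It is off the path to
the headline but it is the paper's own (true) denial of uniqueness in the printed-(D) class — the
instance, at the datum `u⁰`, of Tao's remark "the same loophole can also be used to easily
demonstrate failure of uniqueness for the periodic Navier-Stokes problem" (Anal. PDE 2013, §1),
which the tree now has in general (`Literature.Analysis.FluidPDE.setOf_periodicSolution_infinite`).

* `theorem22_holds` — `Theorem22 ν` for every `ν ≥ 0` (the paper has `ν > 0`, p. 1). (C1) is the
  general orbit theorem applied to the `g ≡ 0` member of Lemma 2.1; (C2) unbounded = the member
  `g(t) = ½t²` (`u = e^{−βt}u⁰(x + ½t²·1) − t·1`, `p = e^{−2βt}P⁰(…) + (x₁+x₂+x₃)`: `‖u(n, z* − ½n²·1)‖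
  = n√3` at a zero `z* = (3/8)(1,1,1)` of `u⁰`, `p(0, n e₁) = n`); (C2) bounded periodic = the
  `g ≡ 0` member (`e^{−βt} ≤ 1` needs `ν ≥ 0`; `|P⁰| ≤ ½ sup|u⁰|² + (3/2)(2π)²` by `basePressure_eq`).
  For `ν < 0` the bounded clause fails for this family (backward heat growth), so the hypothesis
  `0 ≤ ν` is not an artefact.

WHAT THIS IS NOT: not a claim about NS regularity or blow-up; not a claim about any author beyond
the typed locator.
-/

noncomputable section

-- summit-side namespace convention `Summit.NavierStokesRegularity.NavierStokesRegularity.…` (CONVENTIONS §2)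
set_option linter.dupNamespace false

open Set Function Real Filter
open scoped ContDiff Topology

namespace Summit.NavierStokesRegularity.NavierStokesRegularity.Theorems.Jormakka2010

open Literature.Analysis.FluidPDE Literature.Claims.NS.Jormakka2010

/-! ### Small facts about the explicit objects -/

/-- `(1,1,1) ≠ 0`. [folklore] -/
private theorem ones_ne_zero' : ones ≠ 0 := by
  intro h
  have := congrArg (fun v : EuclideanSpace ℝ (Fin 3) => v 0) h
  simp [ones] at this

/-- `sin(3π/4) + cos(3π/4) = 0`, written with `2π · 3/8`. [folklore] -/
private theorem sin_add_cos_three_eighths : sin (2 * π * (3 / 8)) + cos (2 * π * (3 / 8)) = 0 := by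
  rw [show 2 * π * (3 / 8) = π - π / 4 by ring, sin_pi_sub, cos_pi_sub, sin_pi_div_four,
    cos_pi_div_four]
  ring

/-- `u⁰` vanishes at `z* = (3/8)(1,1,1)` (each component is `2π(sin 3π/4 + cos 3π/4) = 0`).
[cite: Jormakka2010, Lemma 2.1 p.2] -/
theorem initialField_threeEighths : initialField ((3 / 8 : ℝ) • ones) = 0 := by
  ext i
  fin_cases i <;> simp [initialField, ones, sin_add_cos_three_eighths]

/-- `P⁰(0) = 0`. [cite: Jormakka2010, Lemma 2.1 eq. (2.1) p.2] -/
theorem basePressure_zero : basePressure 0 = 0 := by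
  simp [basePressure]

/-- `P⁰(n e₁) = 0` for `n : ℕ` (lattice periodicity). [cite: Jormakka2010, Lemma 2.1 eq. (2.1) p.2] -/
theorem basePressure_natMul_single (n : ℕ) :
    basePressure ((n : ℝ) • EuclideanSpace.single (0 : Fin 3) (1 : ℝ)) = 0 := by
  have hper : Literature.Analysis.FunctionSpaces.Torus.IsLatticePeriodic basePressure :=
    isLatticePeriodic_basePressure
  have h := hper.add_int_smul_single (0 : Fin 3) (n : ℤ) 0
  simp only [zero_add, Int.cast_natCast] at h
  rw [h, basePressure_zero]

/-- `|P⁰(z)| ≤ ½ (sup |u⁰|)² + (3/2)(2π)²` from `P⁰ = −½|u⁰|² + (3/2)(2π)²`.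
[cite: Jormakka2010, Lemma 2.1 eq. (2.1) p.2] -/
theorem abs_basePressure_le {C₀ : ℝ} (hC₀ : ∀ x, ‖initialField x‖ ≤ C₀)
    (z : EuclideanSpace ℝ (Fin 3)) : |basePressure z| ≤ C₀ ^ 2 / 2 + 3 / 2 * (2 * π) ^ 2 := by
  rw [basePressure_eq]
  have h1 : ‖initialField z‖ ^ 2 ≤ C₀ ^ 2 :=
    pow_le_pow_left₀ (norm_nonneg _) (hC₀ z) 2
  have h2 : 0 ≤ ‖initialField z‖ ^ 2 := sq_nonneg _
  rw [abs_le]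
  constructor <;> nlinarith [Real.pi_pos]

/-! ### The gauges `g ≡ 0` and `g(t) = ½t²` -/

/-- `d/dt (½t²) = t`. [folklore] -/
private theorem hasDerivAt_halfSq (t : ℝ) : HasDerivAt (fun s : ℝ => s ^ 2 / 2) t t := by
  have e : (fun s : ℝ => s ^ 2 / 2) = fun s => s * s / 2 := by
    funext s
    ring
  rw [e]
  exact (((hasDerivAt_id' t).mul (hasDerivAt_id' t)).div_const 2).congr_deriv (by ring)

/-- `(½t²)′ = t` as functions. [folklore] -/
private theorem deriv_halfSq : deriv (fun s : ℝ => s ^ 2 / 2) = fun t => t :=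
  funext fun t => (hasDerivAt_halfSq t).deriv

/-- `(½t²)″ = 1`. [folklore] -/
private theorem deriv_deriv_halfSq (t : ℝ) : deriv (deriv (fun s : ℝ => s ^ 2 / 2)) t = 1 := by
  rw [deriv_halfSq]
  exact deriv_id t

/-- The `g ≡ 0` member is `u = e^{−βt}u⁰`, `p = e^{−2βt}P⁰`. [cite: Jormakka2010, Theorem 2.2 (proof) p.3] -/
private theorem velocity_const_zero (ν t : ℝ) (x : EuclideanSpace ℝ (Fin 3)) :
    velocity ν (fun _ => 0) t x = exp (-((2 * π) ^ 2 * ν * t)) • initialField x := by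
  simp [velocity]

/-- The pressure of the `g ≡ 0` member. [cite: Jormakka2010, Theorem 2.2 (proof) p.3] -/
private theorem pressure_const_zero (ν t : ℝ) (x : EuclideanSpace ℝ (Fin 3)) :
    pressure ν (fun _ => 0) t x = exp (-(2 * ((2 * π) ^ 2 * ν * t))) * basePressure x := by
  simp [pressure]

/-! ### Theorem 2.2 -/

/-- **Theorem 2.2 (p. 3: C1 infinitely many smooth solutions with the same periodic datum and
`f ≡ 0`; C2 an unbounded one, and a bounded one periodic in `x`) holds for every `ν ≥ 0`.**
C1: the Galilean orbit of the `g ≡ 0` member (`setOf_periodicSolution_infinite`, Tao 2013 §1/§4);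
C2 unbounded: `g(t) = ½t²`; C2 bounded periodic: `g ≡ 0`. [cite: Jormakka2010, Theorem 2.2 p.3] -/
theorem theorem22_holds {ν : ℝ} (hν : 0 ≤ ν) : Theorem22 ν := by
  obtain ⟨C₀, hC₀⟩ := isLatticePeriodic_initialField.exists_forall_norm_le
    (contDiff_initialField (n := ∞)).continuous
  have hC₀' : 0 ≤ C₀ := le_trans (norm_nonneg _) (hC₀ 0)
  -- the `g ≡ 0` member and the `g = ½t²` member, from Lemma 2.1
  obtain ⟨hu0, hp0, hns0⟩ := (lemma21_holds ν).2 (fun _ => 0) contDiff_const rfl (by simp)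
  have hgq : ContDiff ℝ ∞ (fun s : ℝ => s ^ 2 / 2) := (contDiff_id.pow 2).div_const 2
  obtain ⟨huq, hpq, hnsq⟩ := (lemma21_holds ν).2 (fun s : ℝ => s ^ 2 / 2) hgq (by simp)
    (by rw [deriv_halfSq])
  refine ⟨initialField, isPeriodicDatum_initialField, ?_, ?_, ?_⟩
  · -- C1: infinitely many (the orbit of the `g ≡ 0` member, then forget periodicity)
    have hinf := setOf_periodicSolution_infinite hns0 hu0 hp0
      (fun t _ => isLatticePeriodic_velocity ν _ t) ones_ne_zero'
    exact hinf.mono fun q hq => ⟨hq.1, hq.2.1, hq.2.2.1⟩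
  · -- C2, unbounded: `g(t) = ½t²`
    refine ⟨velocity ν (fun s : ℝ => s ^ 2 / 2), pressure ν (fun s : ℝ => s ^ 2 / 2), huq, hpq, hnsq,
      ?_, ?_⟩
    · rintro ⟨C, hC⟩
      obtain ⟨n, hn⟩ := exists_nat_gt (C / ‖ones‖)
      have hone : 0 < ‖ones‖ := norm_pos_iff.2 ones_ne_zero'
      have h := hC n (Nat.cast_nonneg n) ((3 / 8 : ℝ) • ones - ((n : ℝ) ^ 2 / 2) • ones)
      have hval : velocity ν (fun s : ℝ => s ^ 2 / 2) n
          ((3 / 8 : ℝ) • ones - ((n : ℝ) ^ 2 / 2) • ones) = -((n : ℝ) • ones) := by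
        simp only [velocity, deriv_halfSq, sub_add_cancel, initialField_threeEighths, smul_zero,
          zero_sub]
      rw [hval, norm_neg, norm_smul, Real.norm_natCast] at h
      have : C / ‖ones‖ * ‖ones‖ = C := div_mul_cancel₀ C hone.ne'
      nlinarith [mul_lt_mul_of_pos_right hn hone]
    · rintro ⟨C, hC⟩
      obtain ⟨n, hn⟩ := exists_nat_gt C
      have h := hC 0 le_rfl ((n : ℝ) • EuclideanSpace.single (0 : Fin 3) (1 : ℝ))
      have hval : pressure ν (fun s : ℝ => s ^ 2 / 2) 0
          ((n : ℝ) • EuclideanSpace.single (0 : Fin 3) (1 : ℝ)) = n := by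
        simp only [pressure, deriv_deriv_halfSq]
        simp [basePressure_natMul_single]
      rw [hval, abs_of_nonneg (Nat.cast_nonneg n)] at h
      linarith
  · -- C2, bounded and periodic: `g ≡ 0`
    refine ⟨velocity ν (fun _ => 0), pressure ν (fun _ => 0), hu0, hp0, hns0,
      ⟨C₀ + (C₀ ^ 2 / 2 + 3 / 2 * (2 * π) ^ 2), fun t ht x => ⟨?_, ?_⟩⟩, fun t _ => ⟨?_, ?_⟩⟩
    · rw [velocity_const_zero, norm_smul, Real.norm_eq_abs, abs_of_pos (exp_pos _)]
      have he : exp (-((2 * π) ^ 2 * ν * t)) ≤ 1 := by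
        rw [exp_le_one_iff]
        have : 0 ≤ (2 * π) ^ 2 * ν * t := by positivity
        linarith
      calc exp (-((2 * π) ^ 2 * ν * t)) * ‖initialField x‖ ≤ 1 * C₀ :=
          mul_le_mul he (hC₀ x) (norm_nonneg _) zero_le_one
        _ ≤ C₀ + (C₀ ^ 2 / 2 + 3 / 2 * (2 * π) ^ 2) := by rw [one_mul]; nlinarith [Real.pi_pos]
    · rw [pressure_const_zero, abs_mul, abs_of_pos (exp_pos _)]
      have he : exp (-(2 * ((2 * π) ^ 2 * ν * t))) ≤ 1 := by
        rw [exp_le_one_iff]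
        have : 0 ≤ (2 * π) ^ 2 * ν * t := by positivity
        linarith
      calc exp (-(2 * ((2 * π) ^ 2 * ν * t))) * |basePressure x|
          ≤ 1 * (C₀ ^ 2 / 2 + 3 / 2 * (2 * π) ^ 2) :=
            mul_le_mul he (abs_basePressure_le hC₀ x) (abs_nonneg _) zero_le_one
        _ ≤ C₀ + (C₀ ^ 2 / 2 + 3 / 2 * (2 * π) ^ 2) := by rw [one_mul]; linarith
    · exact isLatticePeriodic_velocity ν _ t
    · exact isLatticePeriodic_pressure ν (by simp)

end Summit.NavierStokesRegularity.NavierStokesRegularity.Theorems.Jormakka2010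

end

-- WHAT THIS IS NOT: not a claim about NS regularity or blow-up; not a claim about any author beyond the
-- typed locator.
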